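import Mathlib
import HarnessLib
import Summits.CriticalPhenomena.Ising3DConformalLimit.Theses.HyperoctahedralRP
import Summits.CriticalPhenomena.Ising3DConformalLimit.Theorems.HyperoctahedralRPHRP2Rigidity
import Summits.CriticalPhenomena.Ising3DConformalLimit.Theorems.HyperoctahedralRPTwoPointKernelOfLimit

/-!
# `TwoPointLimitIsotropic` — two-point isotropy of the critical `ℤ³` Ising scaling limit
(route HyperoctahedralRP, milestone item stmt-CriticalPhenomena-1984: PROOF)

For every non-degenerate, translation-invariant, scale-covariant pointwise scaling limit `S` of the
critical nearest-neighbour Ising correlators on `ℤ³` (renormalisation `ρ > 0` on `(0,1]`), the two-point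
function is isotropic: `S 2 (0, R x) = S 2 (0, x)` for every linear isometry `R` of `ℝ³` and `x ≠ 0`
(`twoPointLimitIsotropic_proof`, literally the route decl `TwoPointLimitIsotropic`).

The milestone is, by the route's design, the crux composed with the glue:
* GLUE (`twoPointKernelOfLimit_proof`, `Theorems/HyperoctahedralRPTwoPointKernelOfLimit{Clauses,}.lean`,
  with the nine-mirror lattice reflection positivity `criticalCorrNineMirrorRP_proof`,
  `Theorems/HyperoctahedralRPCriticalCorrNineMirrorRP.lean`): the kernel `K x = S 2 (0, x)` of such a
  limit lies in the window `1/2 ≤ Δ ≤ 1`, is continuous and positive off `0`, homogeneous of degree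
  `-2Δ`, and invariant and reflection positive with respect to the nine lattice mirrors `e_i, e_i ± e_j`
  (FILS 1978 reflection positivity passed to the limit);
* CRUX (`HRP2Rigidity_of`, `Theorems/HyperoctahedralRPHRP2Rigidity.lean`, line `xray-mellin-transfer`
  of item stmt-1979 and its sibling stmt-4800): such kernels are `O(3)`-invariant.
The reduction `HRP2Rigidity → TwoPointLimitIsotropic` with the intermediate
`HRP2Rigidity → TwoPointKernelOfLimit → TwoPointLimitIsotropic` is recorded separately in
`Theorems/HyperoctahedralRPTwoPointLimitIsotropic.lean`; this file is the self-contained composition.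

Rotation invariance of the critical scaling limit on `ℤ³` is listed as open in H. Duminil-Copin,
ICM 2022, §8.1; this is its two-point form under the existence / scale-covariance hypotheses of the
route. No definitions are introduced.
-/

namespace Summit.CriticalPhenomena.Ising3DConformalLimit.HyperoctahedralRPTwoPoint

open Literature.Probability.LatticeModels
open Summit.CriticalPhenomena.Ising3DConformalLimit.Theses.HyperoctahedralRP

/-- **Two-point isotropy of the critical `ℤ³` Ising scaling limit** (`TwoPointLimitIsotropic`, item
stmt-CriticalPhenomena-1984): for every pointwise scaling limit `S` of `criticalCorr 3` with
renormalisation `ρ > 0` on `(0,1]` which is non-degenerate, translation invariant and scale covariant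
with dimension `Δ`, `S 2 (0, R x) = S 2 (0, x)` for all linear isometries `R` and all `x ≠ 0`.
Proof: the kernel `x ↦ S 2 (0, x)` satisfies the hypotheses of nine-mirror RP rigidity
(`twoPointKernelOfLimit_proof`) and nine-mirror RP rigidity holds (`HRP2Rigidity_of`).
[cite: DuminilCopinICM2022, §8.1] -/
theorem twoPointLimitIsotropic_proof : TwoPointLimitIsotropic := by
  intro ρ Δ S hρ hlim hnd htr hsc R x _hx
  obtain ⟨hΔ, hcont, hpos, hhom, hmirror⟩ := twoPointKernelOfLimit_proof ρ Δ S hρ hlim hnd htr hsc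
  exact Summit.CriticalPhenomena.Ising3DConformalLimit.Cruxes.HRP2Rigidity.XRayMellin.HRP2Rigidity_of Δ
    (fun x => S 2 ![0, x]) hΔ.1 hΔ.2 hcont hpos hhom hmirror R x

/-- The two-point kernel of such a limit is `O(3)`-invariant at EVERY point (at `x = 0` trivially,
`R 0 = 0`) — the unguarded form of `TwoPointLimitIsotropic`. [cite: DuminilCopinICM2022, §8.1] -/
theorem kernel_rotation_invariant {ρ : ℝ → ℝ} {Δ : ℝ} {S : CorrFamily 3}
    (hρ : ∀ δ ∈ Set.Ioc (0:ℝ) 1, 0 < ρ δ)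
    (hlim : HasPointwiseScalingLimit (criticalCorr 3) ρ S) (hnd : IsNondegenerateTwoPoint S)
    (htr : IsTranslationInvariant S) (hsc : IsScaleCovariant Δ S)
    (R : EuclideanSpace ℝ (Fin 3) ≃ₗᵢ[ℝ] EuclideanSpace ℝ (Fin 3)) (x : EuclideanSpace ℝ (Fin 3)) :
    S 2 ![0, R x] = S 2 ![0, x] := by
  obtain ⟨hΔ, hcont, hpos, hhom, hmirror⟩ := twoPointKernelOfLimit_proof ρ Δ S hρ hlim hnd htr hsc
  exact Summit.CriticalPhenomena.Ising3DConformalLimit.Cruxes.HRP2Rigidity.XRayMellin.HRP2Rigidity_of Δ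
    (fun x => S 2 ![0, x]) hΔ.1 hΔ.2 hcont hpos hhom hmirror R x

end Summit.CriticalPhenomena.Ising3DConformalLimit.HyperoctahedralRPTwoPoint
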